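import Literature.AlgebraicTopology.SingularHomology.CechSingularBridge
import Literature.AlgebraicTopology.SingularHomology.SphereHomology
import HarnessLib

/-!
# The Čech complex of functions on the nerve of a good cover of a contractible space is exact

Topic `AlgebraicTopology/SingularHomology`; namespace
`Literature.AlgebraicTopology.SingularHomology` (grouping sub-namespace `CechNerve`).
Definitions with body and theorems; no named fact, no instance, no `sorry`.

Let `𝔘 = (U_i)_{i ∈ ι}` be a family of subsets of a space `X` and `M` an `R`-module.  The
NERVE `N_p(𝔘) = {J : Fin (p+1) → ι | U_J ≠ ∅}` (ordered, all tuples; `CechNerve.Nerve`) with its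
faces `J ↦ J ∘ δ_j` carries the complex of ALL `M`-valued functions

`0 → M —ε→ Fun(N₀, M) —δ→ Fun(N₁, M) —δ→ Fun(N₂, M) → ⋯`, `(δ f)(J) = Σ_j (-1)^j f(J ∘ δ_j)`

(`cechFunCoaug`, `cechFunD`; `δ ∘ δ = 0`, `cechFunD_cechFunD`).  When every non-empty `U_J` is
path connected this is, degree by degree, the Čech complex `C^•(𝔘, Z⁰)` of `0`-COCYCLES of the
tree's `Literature/AlgebraicTopology/SingularHomology/CechSingular` (a `0`-cocycle on a path
connected set is constant: evaluation at a chosen point `cechTheta` is a bijective cochain map,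
`cechTheta_cechZeroδ`, `cechTheta_bijective`).  Also: change of coefficients in the dual complex
(`dualObjCongr`) and the vanishing `H^p_X(W; M) = 0` (`p > 0`) for contractible `W` with
coefficients `M` in the universe of the ring (`isZero_homology_subsetCochains_of_contractibleSpace`).
The exactness of the complex for a good open cover of a contractible space (Leray,
[BottTu1982Forms, Thm. 8.9 / 15.8], via the tree's `cechSingularEquiv`) is derived in the sequel
`CechNerveFunctionsExact`; it is the input of the equivariant coresolution
`0 → M → Fun(N₀, M) → ⋯` used for Brown's finiteness criterion
(`Literature/Algebra/Homology/GroupCohomologyCoresolutionFiniteExact`).  Everything is in one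
universe `u` (space, ring, coefficients, indices).

## References

* R. Bott, L. W. Tu, *Differential Forms in Algebraic Topology*, GTM 82 (1982), §8 Thm. 8.9, §15
  Thm. 15.8 [BottTu1982Forms].
* A. Hatcher, *Algebraic Topology*, CUP 2002, §2.1 Prop. 2.21, §3.1 pp. 197–201 [HatcherAT2002].
* K. S. Brown, *Cohomology of Groups*, GTM 87 (1982), VII §4 [Brown1982CohomologyGroups].
-/

noncomputable section

open CategoryTheory Limits

universe u

namespace Literature.AlgebraicTopology.SingularHomology

variable {R : Type u} [CommRing R] {X : Type u} {M : Type u} [AddCommGroup M] [Module R M]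

/-! ### Constant `0`-cochains; `0`-cocycles on path connected sets are constant -/

section ZeroCochains

variable [TopologicalSpace X]

variable (R) in
/-- **The constant `0`-cochain** with value `m` on `A`: `Σ r_σ σ ↦ Σ r_σ • m` (the `M`-valued
version of the tree's `unitCochain`). [cite: HatcherAT2002, §3.1 p. 199] -/
def constCochainOn (A : Set X) (m : M) : CochainOn R M A 0 where
  toFun c := Finsupp.linearCombination R (fun _ : SingularSimplex X 0 => m) (c.1 : CChain R X 0)
  map_add' c c' := map_add (Finsupp.linearCombination R (fun _ : SingularSimplex X 0 => m)) c.1 c'.1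
  map_smul' r c := map_smul (Finsupp.linearCombination R (fun _ : SingularSimplex X 0 => m)) r c.1

/-- Unfolding lemma for `constCochainOn`. [folklore] -/
theorem constCochainOn_apply (A : Set X) (m : M) :
    ∀ c, constCochainOn R A m c =
      Finsupp.linearCombination R (fun _ : SingularSimplex X 0 => m) (c.1 : CChain R X 0) :=
  fun _ => rfl

/-- The constant cochain takes the value `m` on every `0`-simplex of `A`. [folklore] -/
theorem evalSimplex_constCochainOn {A : Set X} (m : M) {σ : SingularSimplex X 0} (hσ : σ.range ⊆ A) :
    evalSimplex (constCochainOn R A m) σ = m := by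
  rw [evalSimplex_of_subset _ hσ, constCochainOn_apply, coe_elemChain, Finsupp.linearCombination_single,
    one_smul]

/-- **The constant cochain is a cocycle**: `δ(const)(τ) = m - m = 0`. [cite: HatcherAT2002, §3.1 p. 199] -/
theorem cod_constCochainOn (A : Set X) (m : M) : cod A 0 (constCochainOn R A m) = 0 := by
  refine LinearMap.ext fun c => ?_
  rw [cod_apply, LinearMap.zero_apply, constCochainOn_apply, toComplex_d_val]
  suffices hz : (Finsupp.linearCombination R (fun _ : SingularSimplex X 0 => m)) ∘ₗ
      csingularChainComplex.bd R 0 = 0 by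
    rw [← LinearMap.comp_apply, hz, LinearMap.zero_apply]
  refine Finsupp.lhom_ext fun τ r => ?_
  rw [LinearMap.comp_apply, csingularChainComplex.bd_single, map_sum, Fin.sum_univ_two,
    map_smul, map_smul, Finsupp.linearCombination_single, Finsupp.linearCombination_single,
    LinearMap.zero_apply]
  simp

/-- The constant cochain is a `0`-cocycle. [folklore] -/
theorem constCochainOn_mem_zeroCocycles (A : Set X) (m : M) :
    constCochainOn R A m ∈ zeroCocycles R M A :=
  LinearMap.mem_ker.2 (cod_constCochainOn A m)

/-- **A `0`-cocycle takes the same value at points joined by a path in `A`** (evaluate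
`δψ = 0` on the singular `1`-simplex of the path, Hatcher 2002, §3.1 p. 199).
[cite: HatcherAT2002, §3.1 p. 199] -/
theorem evalSimplex_ofPoint_eq_of_joinedIn {A : Set X} {ψ : CochainOn R M A 0}
    (hψ : cod A 0 ψ = 0) {x y : X} (h : JoinedIn A x y) :
    evalSimplex ψ (SingularSimplex.ofPoint x) = evalSimplex ψ (SingularSimplex.ofPoint y) := by
  have hx : (SingularSimplex.ofPoint x).range ⊆ A := by
    rw [SingularSimplex.range_ofPoint]; exact Set.singleton_subset_iff.2 h.source_mem
  have hy : (SingularSimplex.ofPoint y).range ⊆ A := by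
    rw [SingularSimplex.range_ofPoint]; exact Set.singleton_subset_iff.2 h.target_mem
  obtain ⟨γ, hγ⟩ := h
  have hτ : (SingularSimplex.ofPath γ).range ⊆ A :=
    (SingularSimplex.range_ofPath_subset γ).trans (by rintro _ ⟨t, rfl⟩; exact hγ t)
  have hcocycle : ψ (((chainsInSub R R X A).toComplex.d 1 0).hom (elemChain (R := R) hτ)) = 0 := by
    rw [← cod_apply, hψ, LinearMap.zero_apply]
  have hbd : ((chainsInSub R R X A).toComplex.d 1 0).hom (elemChain (R := R) hτ) =
      elemChain hy - elemChain hx := by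
    apply Subtype.ext
    rw [toComplex_d_val]
    change csingularChainComplex.bd R 0 (Finsupp.single (SingularSimplex.ofPath γ) (1 : R)) =
      ((Finsupp.single (SingularSimplex.ofPoint y) (1 : R) : CChain R X 0) -
        (Finsupp.single (SingularSimplex.ofPoint x) (1 : R) : CChain R X 0) : CChain R X 0)
    rw [csingularChainComplex.bd_single, Fin.sum_univ_two, SingularSimplex.ofPath_face_zero,
      SingularSimplex.ofPath_face_one]
    simp [sub_eq_add_neg]
  rw [hbd, map_sub, sub_eq_zero] at hcocycle
  rw [evalSimplex_of_subset _ hx, evalSimplex_of_subset _ hy, hcocycle]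

/-- **A `0`-cocycle on a path connected set is the constant cochain of its value at any point.**
[cite: HatcherAT2002, §3.1 p. 199] -/
theorem eq_constCochainOn_of_isPathConnected {A : Set X} (hA : IsPathConnected A)
    {ψ : CochainOn R M A 0} (hψ : cod A 0 ψ = 0) {x : X} (hx : x ∈ A) :
    ψ = constCochainOn R A (evalSimplex ψ (SingularSimplex.ofPoint x)) := by
  refine ext_evalSimplex fun σ hσ => ?_
  rw [evalSimplex_constCochainOn _ hσ]
  have hpt : σ.pt ∈ A := hσ (SingularSimplex.pt_mem_range σ)
  rw [← SingularSimplex.ofPoint_pt σ]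
  exact evalSimplex_ofPoint_eq_of_joinedIn hψ (hA.joinedIn _ hpt _ hx)

/-- Cochains of the empty set are all equal (its chain modules vanish). [folklore] -/
theorem CochainOn.eq_of_eq_empty {A : Set X} (hA : A = ∅) {q : ℕ} (ψ ψ' : CochainOn R M A q) :
    ψ = ψ' := by
  refine LinearMap.ext fun x => ?_
  have hx : x = 0 := by
    apply Subtype.ext
    have h := (mem_chainsIn_iff R R _).1 x.2
    change (x.1 : CChain R X q) = 0
    refine Finsupp.ext fun σ => ?_
    by_contra hσ
    exact (SingularSimplex.range_nonempty σ).ne_empty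
      (Set.subset_empty_iff.1 (hA ▸ h σ (Finsupp.mem_support_iff.2 hσ)))
  rw [hx, map_zero, map_zero]

end ZeroCochains

/-! ### The nerve and the Čech complex of functions -/

namespace CechNerve

variable {ι : Type u} (U : ι → Set X)

/-- **The (ordered) nerve** of the family `𝔘`: tuples `J : Fin (p+1) → ι` with `U_J ≠ ∅`.
[cite: BottTu1982Forms, §8] -/
def Nerve (p : ℕ) : Type u :=
  {J : Fin (p + 1) → ι // (cechSet U J).Nonempty}

namespace Nerve

variable {U}

/-- The `j`-th face `J ∘ δ_j` of a simplex of the nerve (`U_{J ∘ δ_j} ⊇ U_J ≠ ∅`). [folklore] -/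
def face {p : ℕ} (j : Fin (p + 2)) (J : Nerve U (p + 1)) : Nerve U p :=
  ⟨J.1 ∘ Fin.succAbove j, J.2.mono (cechSet_subset_comp U J.1 (Fin.succAbove j))⟩

/-- The underlying tuple of a face. [folklore] -/
@[simp]
theorem coe_face {p : ℕ} (j : Fin (p + 2)) (J : Nerve U (p + 1)) :
    (face j J).1 = J.1 ∘ Fin.succAbove j :=
  rfl

/-- A chosen point of `U_J`. [folklore] -/
def pt {p : ℕ} (J : Nerve U p) : X :=
  J.2.some

/-- The chosen point lies in `U_J`. [folklore] -/
theorem pt_mem {p : ℕ} (J : Nerve U p) : J.pt ∈ cechSet U J.1 :=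
  J.2.some_mem

/-- The `0`-simplex at the chosen point lies in `U_J`. [folklore] -/
theorem range_ofPoint_pt_subset [TopologicalSpace X] {p : ℕ} (J : Nerve U p) :
    (SingularSimplex.ofPoint J.pt).range ⊆ cechSet U J.1 := by
  rw [SingularSimplex.range_ofPoint]
  exact Set.singleton_subset_iff.2 J.pt_mem

end Nerve

variable (R M)

/-- **The Čech differential on functions on the nerve**, `(δ f)(J) = Σ_j (-1)^j f(J ∘ δ_j)`.
[cite: BottTu1982Forms, §8 (8.4)] -/
def cechFunD (p : ℕ) : (Nerve U p → M) →ₗ[R] (Nerve U (p + 1) → M) :=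
  ∑ j : Fin (p + 2), (-1 : R) ^ (j : ℕ) • LinearMap.funLeft R M (Nerve.face j)

/-- **The coaugmentation** `M → Fun(N₀, M)` by constant functions. [cite: BottTu1982Forms, Thm. 8.9] -/
def cechFunCoaug : M →ₗ[R] (Nerve U 0 → M) where
  toFun m _ := m
  map_add' _ _ := rfl
  map_smul' _ _ := rfl

variable {R M U}

/-- The Čech differential, componentwise. [cite: BottTu1982Forms, §8 (8.4)] -/
theorem cechFunD_apply {p : ℕ} (f : Nerve U p → M) (J : Nerve U (p + 1)) :
    cechFunD R M U p f J = ∑ j : Fin (p + 2), (-1 : R) ^ (j : ℕ) • f (Nerve.face j J) := by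
  simp [cechFunD, LinearMap.sum_apply, Finset.sum_apply, LinearMap.funLeft_apply]

/-- The coaugmentation is the constant function. [folklore] -/
@[simp]
theorem cechFunCoaug_apply (m : M) (J : Nerve U 0) : cechFunCoaug R M U m J = m :=
  rfl

/-- **`δ ∘ δ = 0`** (cancellation of the faces in pairs). [cite: BottTu1982Forms, §8 Prop. 8.3] -/
theorem cechFunD_cechFunD {p : ℕ} (f : Nerve U p → M) :
    cechFunD R M U (p + 1) (cechFunD R M U p f) = 0 := by
  funext J
  rw [cechFunD_apply, Pi.zero_apply]
  simp_rw [cechFunD_apply, Finset.smul_sum]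
  have h := Literature.Algebra.Homology.CechTuple.sum_sum_neg_one_pow_smul_smul_faces_eq_zero
    (R := R) (fun θ : Fin (p + 1) → Fin (p + 3) =>
      f ⟨J.1 ∘ θ, J.2.mono (cechSet_subset_comp U J.1 θ)⟩)
  exact h

/-- `δ ∘ ε = 0`. [folklore] -/
theorem cechFunD_cechFunCoaug (m : M) : cechFunD R M U 0 (cechFunCoaug R M U m) = 0 := by
  funext J
  rw [cechFunD_apply, Fin.sum_univ_two, Pi.zero_apply]
  simp

/-! ### Comparison with the Čech complex of `0`-cocycles -/

section Topology

variable [TopologicalSpace X]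

variable (R M U) in
/-- **Evaluation at the chosen points**: `C^p(𝔘, Z⁰) → Fun(N_p, M)`, `b ↦ (J ↦ b_J(x_J))`.
[cite: BottTu1982Forms, Thm. 8.9] -/
def cechTheta (p : ℕ) : CechZeroCocycles R M U p →ₗ[R] (Nerve U p → M) where
  toFun b J := evalSimplex (b J.1 : CochainOn R M (cechSet U J.1) 0) (SingularSimplex.ofPoint J.pt)
  map_add' b b' := by
    funext J
    rw [Pi.add_apply, Pi.add_apply, Submodule.coe_add, evalSimplex_add]
  map_smul' r b := by
    funext J
    rw [RingHom.id_apply, Pi.smul_apply, Pi.smul_apply, Submodule.coe_smul, evalSimplex_smul]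

/-- Unfolding lemma for `cechTheta`. [folklore] -/
theorem cechTheta_apply {p : ℕ} (b : CechZeroCocycles R M U p) (J : Nerve U p) :
    cechTheta R M U p b J =
      evalSimplex (b J.1 : CochainOn R M (cechSet U J.1) 0) (SingularSimplex.ofPoint J.pt) :=
  rfl

/-- On a path connected `U_J` the value of a `0`-cocycle does not depend on the point.
[cite: HatcherAT2002, §3.1 p. 199] -/
theorem evalSimplex_zeroCocycle_eq {J : Set X} (hJ : IsPathConnected J)
    (ψ : ↥(zeroCocycles R M J)) {x y : X} (hx : x ∈ J) (hy : y ∈ J) :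
    evalSimplex (ψ : CochainOn R M J 0) (SingularSimplex.ofPoint x) =
      evalSimplex (ψ : CochainOn R M J 0) (SingularSimplex.ofPoint y) :=
  evalSimplex_ofPoint_eq_of_joinedIn (LinearMap.mem_ker.1 ψ.2) (hJ.joinedIn x hx y hy)

/-- **`cechTheta` is a cochain map**: `Θ (δ b) = δ (Θ b)` when every non-empty `U_J` is path
connected (restriction does not change values; a cocycle has the same value at the chosen points
of `U_J` and `U_{J ∘ δ_j}`). [cite: BottTu1982Forms, Thm. 8.9] -/
theorem cechTheta_cechZeroδ (hpc : ∀ (p : ℕ) (J : Nerve U p), IsPathConnected (cechSet U J.1))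
    {p : ℕ} (b : CechZeroCocycles R M U p) :
    cechTheta R M U (p + 1) (cechZeroδ R M U p b) = cechFunD R M U p (cechTheta R M U p b) := by
  funext J
  rw [cechTheta_apply, cechFunD_apply, coe_cechZeroδ_apply, evalSimplex_sum]
  refine Finset.sum_congr rfl fun j _ => ?_
  rw [evalSimplex_smul, evalSimplex_cres _ _ (Nerve.range_ofPoint_pt_subset J), cechTheta_apply]
  congr 1
  exact evalSimplex_zeroCocycle_eq (hpc p (Nerve.face j J)) (b (J.1 ∘ Fin.succAbove j))
    ((cechSet_subset_comp U J.1 (Fin.succAbove j)) J.pt_mem) (Nerve.face j J).pt_mem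

/-- **`cechTheta` is injective** when every non-empty `U_J` is path connected (a `0`-cocycle on
a path connected set is determined by one value; on `U_J = ∅` there is only one cochain).
[cite: HatcherAT2002, §3.1 p. 199] -/
theorem cechTheta_injective (hpc : ∀ (p : ℕ) (J : Nerve U p), IsPathConnected (cechSet U J.1))
    (p : ℕ) : Function.Injective (cechTheta R M U p) := by
  intro b b' h
  funext J
  apply Subtype.ext
  by_cases hJ : (cechSet U J).Nonempty
  · have hv := congrFun h ⟨J, hJ⟩
    rw [cechTheta_apply, cechTheta_apply] at hv
    change evalSimplex (b J : CochainOn R M (cechSet U J) 0) _ =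
      evalSimplex (b' J : CochainOn R M (cechSet U J) 0) _ at hv
    rw [eq_constCochainOn_of_isPathConnected (hpc p ⟨J, hJ⟩) (LinearMap.mem_ker.1 (b J).2)
        (Nerve.pt_mem ⟨J, hJ⟩),
      eq_constCochainOn_of_isPathConnected (hpc p ⟨J, hJ⟩) (LinearMap.mem_ker.1 (b' J).2)
        (Nerve.pt_mem ⟨J, hJ⟩)]
    exact congrArg _ hv
  · exact CochainOn.eq_of_eq_empty (Set.not_nonempty_iff_eq_empty.1 hJ) _ _

open Classical in
/-- **`cechTheta` is surjective**: the family of constant cocycles with prescribed values.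
[cite: HatcherAT2002, §3.1 p. 199] -/
theorem cechTheta_surjective (p : ℕ) : Function.Surjective (cechTheta R M U p) := by
  intro f
  refine ⟨fun J => if h : (cechSet U J).Nonempty then
      ⟨constCochainOn R (cechSet U J) (f ⟨J, h⟩), constCochainOn_mem_zeroCocycles _ _⟩ else 0, ?_⟩
  funext J
  rw [cechTheta_apply, dif_pos J.2]
  exact evalSimplex_constCochainOn _ (Nerve.range_ofPoint_pt_subset J)

/-- **`cechTheta` is bijective** when every non-empty `U_J` is path connected.
[cite: BottTu1982Forms, Thm. 8.9] -/
theorem cechTheta_bijective (hpc : ∀ (p : ℕ) (J : Nerve U p), IsPathConnected (cechSet U J.1))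
    (p : ℕ) : Function.Bijective (cechTheta R M U p) :=
  ⟨cechTheta_injective hpc p, cechTheta_surjective p⟩

/-! ### Exactness -/

/-- Change of coefficients `N ≅ N'` in the dual complex `Hom_R(K, -)`. [folklore] -/
def dualObjCongr {ι' : Type*} {c : ComplexShape ι'} {N N' : ModuleCat.{u} R} (e : N ≅ N')
    (K : HomologicalComplex (ModuleCat.{u} R) c) : dualObj R N K ≅ dualObj R N' K :=
  HomologicalComplex.Hom.isoOfComponents
    (fun i => (Linear.homCongr R (Iso.refl (K.X i)) e).toModuleIso)
    (fun i j _ => by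
      ext ψ
      change (Iso.refl _).inv ≫ (K.d j i ≫ ψ) ≫ e.hom = K.d j i ≫ ((Iso.refl _).inv ≫ ψ ≫ e.hom)
      simp only [Iso.refl_inv, Category.id_comp, Category.assoc])

/-- **Contractible subsets are acyclic for concrete cochains with coefficients `M`** (same
universe as the ring): `H^p_X(W; M) = 0` for `p > 0` (Hatcher 2002, §3.1 p. 201; via the
coefficient-agnostic identifications of the tree and `ULift M ≅ M`). [cite: HatcherAT2002, §3.1 p. 201] -/
theorem isZero_homology_subsetCochains_of_contractibleSpace (W : Set X) [ContractibleSpace ↥W]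
    {p : ℕ} (hp : p ≠ 0) : IsZero ((subsetCochains R (ModuleCat.of R M) W).homology p) := by
  have e : subsetCochains R (ModuleCat.of R (ULift.{u} M)) W ≅ singularCochainComplex R M (↥W) :=
    dualMapIso (N := ModuleCat.of R (ULift.{u} M)) (subspaceIso R R X W) ≪≫
      (dualMapIso (N := ModuleCat.of R (ULift.{u} M)) (csingularChainComplex.compIso R R (↥W))).symm ≪≫
        (singularCochainComplex.cochainIso R M (↥W)).symm
  have e' : subsetCochains R (ModuleCat.of R (ULift.{u} M)) W ≅ subsetCochains R (ModuleCat.of R M) W :=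
    dualObjCongr (ULift.moduleEquiv (R := R) (M := M)).toModuleIso _
  exact IsZero.of_iso (singularCochainComplex.isZero_singularCohomology_of_subsingleton' hp)
    ((HomologicalComplex.homologyFunctor _ _ p).mapIso (e'.symm ≪≫ e) ≪≫
      (singularCohomology.isoOfContractible R M (↥W) p).symm)

end Topology

end CechNerve

end Literature.AlgebraicTopology.SingularHomology
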